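/-
Copyright: the b2b-balaban T⁴-continuum CRUX team, row NE7b OWNER lineage `t4-ne7b-p1` (gen 124). Project licence.
-/
import Summits.QuantumFields.BalabanUV.T4Continuum.Spine.NE7b.SupZdPerturbedDecay

/-!
# GREEN'S IDENTITY FOR `H_V + K` ON `ℤ^d`: for functions `u, w` with exponential block profiles, a bounded potential `V` and a SYMMETRIC kernel
# `|K(p,q)| ≤ εe^{−γ|p−q|₁}`, `Σ′_pu·(H_V + K)w = Σ′_pw·(H_V + K)u` with every series absolutely convergent — block profiles are summable on
# the fine lattice (injection `p ↦ (blk n p, locFin n p)`), the stencil is symmetric by summation by parts (translations of `ℤ^d`), the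
# block average and the kernel by Fubini on `ℤ^d × ℤ^d`.  The tool that makes the perturbed next-scale Hessian a SYMMETRIC form when `K` is
# symmetric ((232)) (row NE7b, node U5c; (27)∕(189)∕(191) BY NAME; [folklore])

Cell `pub-balaban`, sub-cell `t4`, spine estimate NE7b (`T4WeightBudget.RelWeightBound`; the cell's OWN estimate — NOT PRINTED in
[Bałaban 1983–89], NOT PROVED).  Crux-route work under `Spine/NE7b/` by the row OWNER (`t4-ne7b-p1` gen 124, file (231)) under FREEZE
(0)'s crux-prover clause; NOTHING of Bałaban's is named as a Lean object, valued or asserted; no `T4Continuum/Support` leaf typed; no `def`,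
no notation; zero `sorry`; no road constant (pure lattice analysis).  Imports (BY NAME): the OWNER's (215) `…SupZdPerturbedDecay` (for the
import closure: (27) `blk`, `locFin`, `chart_blk_locFin`, `mem_B`, `sum_B_const`, (189) `summable_exp_l1`, `tsum_exp_l1_le`, (191)
`natAbs_sub_comm_sum`), Mathlib's `Summable.comp_injective`, `Summable.mul_of_nonneg`, `hasSum_fintype`, `Equiv.tsum_eq` (`Equiv.subRight`,
`Equiv.addRight`), `hasSum_sum_of_ne_finset_zero`, `summable_prod_of_nonneg`, `Summable.tsum_comm`, `Summable.tsum_finsetSum`.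

WHY (located).  The `H + K` column's next-scale objects ((216)–(230)) were built on the sup road, where symmetry of `K` is never used; but
`(n+1)^dN_K` is to be the Hessian of an action, and (166)'s floor ∕ any `ℓ²` statement needs `T_K`, `N_K` symmetric.  Symmetry of `T_K(b,c) =
(n+1)^{−d}⟨𝟙_{B n b}, G_K𝟙_{B n c}⟩` is Green's identity `⟨u,(H+K)w⟩ = ⟨(H+K)u,w⟩` for the two decaying block columns — a statement about
absolutely convergent series on `ℤ^d`, proved here once for general `u, w` of block profile: (§1) `Σ_p e^{−μ|blk n p − b|₁} < ∞` by injecting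
`ℤ^d` into `ℤ^d × (Fin d → Fin (n+1))` (block, local coordinates) where the majorant is a product of (189)'s sum and a finite sum; (§2) the
stencil `Σ_pu(p)(2w(p) − w(p±e_μ))` is symmetric by reindexing along `p ↦ p ± e_μ`; the block average `Σ_pu(p)Σ_{q∈B(blk p)}w(q)` is the double
series of `u(p)w(q)𝟙[blk p = blk q]` (rows and columns are finite block sums; Fubini under `|u(p)|B_w𝟙`); the kernel term is Fubini under
`|u(p)|εe^{−γ|p−q|₁}B_w` plus `K(p,q) = K(q,p)`; the potential term is pointwise symmetric.

WHAT IS PROVED ([folklore]): §1 **`summable_blockProfile`**, `summable_of_blockProfile`; §2 **`stencil_symm`**, **`blockAverage_symm`**,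
**`kernel_symm`** (each with its summability); §3 **`green_identity`** (THE END: summability of `u·(H_V+K)w` and the identity).

HONEST (what this is NOT).  Lattice bookkeeping; no `ℓ²` packaging, no positivity of the form; `V` only bounded; nothing of the torus;
nothing of the covariant propagators of [B4]–[B6]; nothing of Bałaban's asserted.  BY-NAME EFFECT ON THE WALL: NONE.  NE7b NOT PRINTED ∕ NOT
PROVED; spine PROVED 0∕9; rung (B)+1 — the programme's measures remain FINITE-torus statements; NOT the mass gap, NOT Clay.  HONEST
DEPENDENCY: continuum YM on T⁴ ⇐ BetaPertH ∧ nine spine estimates (0∕9 proved); BetaPertH ⇐ (D1) ∧ (D4) ∧ CAP+tail; G-an2-4 gates asym, D1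
and NE2∕3∕4.
-/

set_option autoImplicit false

noncomputable section

namespace Summit.QuantumFields.BalabanUV.T4Continuum.NE7b.SupZdGreenIdentity

open Real Filter Topology
open scoped ENNReal
open Literature.MathematicalPhysics.QuantumFieldTheory.Balaban1983to89
open B6QGQLower276 (X e blk B locFin chart mem_B chart_blk_locFin)
open SupZdExponentialSums (summable_exp_l1 tsum_exp_l1_le)

variable {d : ℕ}

/-! ## §1. Block profiles are summable on the fine lattice -/

/-- **A BLOCK PROFILE IS SUMMABLE OVER `ℤ^d`**: `p ↦ e^{−μ|blk n p − b|₁}` is summable on the fine lattice — the injection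
`p ↦ (blk n p, locFin n p)` into `ℤ^d × (Fin d → Fin (n+1))` and (189) on the block lattice. [folklore] -/
theorem summable_blockProfile (n : ℕ) {μ : ℝ} (hμ : 0 < μ) (b : X d) :
    Summable (fun p : X d => exp (-(μ * ∑ i, (((blk n p i - b i).natAbs : ℕ) : ℝ)))) := by
  classical
  obtain ⟨g, hg⟩ : ∃ g : X d × (Fin d → Fin (n + 1)) → ℝ, ∀ x, g x = exp (-(μ * ∑ i, (((x.1 i - b i).natAbs : ℕ) : ℝ))) * 1 :=
    ⟨_, fun _ => rfl⟩
  have hgs : Summable g := by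
    have h := Summable.mul_of_nonneg (f := fun β : X d => exp (-(μ * ∑ i, (((β i - b i).natAbs : ℕ) : ℝ))))
      (g := fun _ : Fin d → Fin (n + 1) => (1 : ℝ)) ?_ (hasSum_fintype _).summable (fun _ => (exp_pos _).le) (fun _ => zero_le_one)
    · exact h.congr fun x => by rw [hg]
    · have h := summable_exp_l1 (d := d) hμ b
      refine h.congr fun β => ?_
      rw [SupZdCoarseForm.natAbs_sub_comm_sum]
  have hinj : Function.Injective (fun p : X d => (blk n p, locFin n p)) := by
    intro p q h
    have h1 : blk n p = blk n q := congrArg Prod.fst h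
    have h2 : locFin n p = locFin n q := congrArg Prod.snd h
    rw [← chart_blk_locFin n p, ← chart_blk_locFin n q, h1, h2]
  have h := hgs.comp_injective hinj
  refine h.congr fun p => ?_
  simp only [Function.comp, hg, mul_one]

/-- A function with a block profile is absolutely summable over `ℤ^d`. [folklore] -/
theorem summable_of_blockProfile (n : ℕ) {μ A : ℝ} (hμ : 0 < μ) (b : X d) (u : X d → ℝ)
    (hu : ∀ p, |u p| ≤ A * exp (-(μ * ∑ i, (((blk n p i - b i).natAbs : ℕ) : ℝ)))) : Summable u :=
  Summable.of_norm_bounded ((summable_blockProfile n hμ b).mul_left A) fun p => by rw [Real.norm_eq_abs]; exact hu p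

/-! ## §2. The three symmetric pieces: stencil (summation by parts), block average (Fubini), kernel (Fubini + symmetry) -/

/-- **SUMMATION BY PARTS FOR THE STENCIL** (two functions with block profiles):
`Σ′_pu(p)(2w(p) − w(p+e_μ) − w(p−e_μ)) = Σ′_pw(p)(2u(p) − u(p+e_μ) − u(p−e_μ))` — reindexing by the translations `p ↦ p ± e_μ`. [folklore] -/
theorem stencil_symm (n : ℕ) {μ A Bw : ℝ} (hμ : 0 < μ) (bu bw : X d) (u w : X d → ℝ)
    (hu : ∀ p, |u p| ≤ A * exp (-(μ * ∑ i, (((blk n p i - bu i).natAbs : ℕ) : ℝ))))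
    (hw : ∀ p, |w p| ≤ Bw * exp (-(μ * ∑ i, (((blk n p i - bw i).natAbs : ℕ) : ℝ)))) (ν : Fin d) :
    Summable (fun p => u p * (2 * w p - w (p + e ν) - w (p - e ν))) ∧
    ∑' p : X d, u p * (2 * w p - w (p + e ν) - w (p - e ν)) = ∑' p : X d, w p * (2 * u p - u (p + e ν) - u (p - e ν)) := by
  have hBw : 0 ≤ Bw := by
    have h := (abs_nonneg _).trans (hw 0)
    exact le_of_mul_le_mul_right (by rw [zero_mul]; exact h) (exp_pos _)
  have hA : 0 ≤ A := by
    have h := (abs_nonneg _).trans (hu 0)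
    exact le_of_mul_le_mul_right (by rw [zero_mul]; exact h) (exp_pos _)
  have hwb : ∀ p, |w p| ≤ Bw := fun p => (hw p).trans (mul_le_of_le_one_right hBw (exp_le_one_iff.2 (neg_nonpos.2 (by positivity))))
  have hub : ∀ p, |u p| ≤ A := fun p => (hu p).trans (mul_le_of_le_one_right hA (exp_le_one_iff.2 (neg_nonpos.2 (by positivity))))
  have hus : Summable u := summable_of_blockProfile n hμ bu u hu
  have hws : Summable w := summable_of_blockProfile n hμ bw w hw
  -- products `u · (w ∘ shift)` and `(u ∘ shift) · w` are summable
  have hprod : ∀ (f g : X d → ℝ) (Bg : ℝ), Summable f → (∀ p, |g p| ≤ Bg) → Summable fun p => f p * g p := by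
    intro f g Bg hf hg
    refine Summable.of_norm_bounded (hf.abs.mul_right Bg) fun p => ?_
    rw [Real.norm_eq_abs, abs_mul]
    exact mul_le_mul_of_nonneg_left (hg p) (abs_nonneg _)
  have h1 : Summable fun p => u p * w p := hprod u w Bw hus hwb
  have h2 : Summable fun p => u p * w (p + e ν) := hprod u (fun p => w (p + e ν)) Bw hus (fun p => hwb _)
  have h3 : Summable fun p => u p * w (p - e ν) := hprod u (fun p => w (p - e ν)) Bw hus (fun p => hwb _)
  have h2' : Summable fun p => w p * u (p + e ν) := hprod w (fun p => u (p + e ν)) A hws (fun p => hub _)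
  have h3' : Summable fun p => w p * u (p - e ν) := hprod w (fun p => u (p - e ν)) A hws (fun p => hub _)
  -- reindexing: `Σ u(p)w(p+e) = Σ u(p−e)w(p)` and `Σ u(p)w(p−e) = Σ u(p+e)w(p)`
  have hshift1 : ∑' p : X d, u p * w (p + e ν) = ∑' p : X d, w p * u (p - e ν) := by
    rw [← (Equiv.subRight (e ν)).tsum_eq (fun p => u p * w (p + e ν))]
    exact tsum_congr fun c => by rw [Equiv.subRight_apply, sub_add_cancel, mul_comm]
  have hshift2 : ∑' p : X d, u p * w (p - e ν) = ∑' p : X d, w p * u (p + e ν) := by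
    rw [← (Equiv.addRight (e ν)).tsum_eq (fun p => u p * w (p - e ν))]
    exact tsum_congr fun c => by rw [Equiv.coe_addRight, add_sub_cancel_right, mul_comm]
  refine ⟨(((h1.mul_left 2).sub h2).sub h3).congr fun p => by ring, ?_⟩
  have eL : ∀ p, u p * (2 * w p - w (p + e ν) - w (p - e ν)) = 2 * (u p * w p) - u p * w (p + e ν) - u p * w (p - e ν) :=
    fun p => by ring
  have eR : ∀ p, w p * (2 * u p - u (p + e ν) - u (p - e ν)) = 2 * (u p * w p) - w p * u (p + e ν) - w p * u (p - e ν) :=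
    fun p => by ring
  rw [tsum_congr eL, tsum_congr eR, ((h1.mul_left 2).sub h2).tsum_sub h3, (h1.mul_left 2).tsum_sub h2,
    ((h1.mul_left 2).sub h2').tsum_sub h3', (h1.mul_left 2).tsum_sub h2', hshift1, hshift2]
  ring

/-- **THE BLOCK-AVERAGE TERM IS SYMMETRIC**: `Σ′_pu(p)Σ_{q∈B(blk p)}w(q) = Σ′_qw(q)Σ_{p∈B(blk q)}u(p)` — Fubini on `ℤ^d × ℤ^d` for
`u(p)w(q)𝟙[blk p = blk q]`. [folklore] -/
theorem blockAverage_symm (n : ℕ) {μ A Bw : ℝ} (hμ : 0 < μ) (bu bw : X d) (u w : X d → ℝ)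
    (hu : ∀ p, |u p| ≤ A * exp (-(μ * ∑ i, (((blk n p i - bu i).natAbs : ℕ) : ℝ))))
    (hw : ∀ p, |w p| ≤ Bw * exp (-(μ * ∑ i, (((blk n p i - bw i).natAbs : ℕ) : ℝ)))) :
    Summable (fun p => u p * ∑ q ∈ B n (blk n p), w q) ∧
    ∑' p : X d, u p * ∑ q ∈ B n (blk n p), w q = ∑' q : X d, w q * ∑ p ∈ B n (blk n q), u p := by
  classical
  have hBw : 0 ≤ Bw := by
    have h := (abs_nonneg _).trans (hw 0)
    exact le_of_mul_le_mul_right (by rw [zero_mul]; exact h) (exp_pos _)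
  have hwb : ∀ p, |w p| ≤ Bw := fun p => (hw p).trans (mul_le_of_le_one_right hBw (exp_le_one_iff.2 (neg_nonpos.2 (by positivity))))
  have hus : Summable u := summable_of_blockProfile n hμ bu u hu
  obtain ⟨F, hF⟩ : ∃ F : X d → X d → ℝ, ∀ p q, F p q = u p * w q * (if blk n q = blk n p then 1 else 0) := ⟨_, fun _ _ => rfl⟩
  -- rows and columns are finite block sums
  have hrow : ∀ p, HasSum (fun q => F p q) (u p * ∑ q ∈ B n (blk n p), w q) := by
    intro p
    have h : ∀ q ∉ B n (blk n p), F p q = 0 := fun q hq => by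
      rw [hF, if_neg (fun h' => hq (mem_B.2 h')), mul_zero]
    have hs : HasSum (fun q => F p q) (∑ q ∈ B n (blk n p), F p q) := hasSum_sum_of_ne_finset_zero h
    have e1 : ∑ q ∈ B n (blk n p), F p q = u p * ∑ q ∈ B n (blk n p), w q := by
      rw [Finset.mul_sum]
      exact Finset.sum_congr rfl fun q hq => by rw [hF, if_pos (mem_B.1 hq), mul_one]
    rw [e1] at hs
    exact hs
  have hcol : ∀ q, HasSum (fun p => F p q) (w q * ∑ p ∈ B n (blk n q), u p) := by
    intro q
    have h : ∀ p ∉ B n (blk n q), F p q = 0 := fun p hp => by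
      rw [hF, if_neg (fun h' => hp (mem_B.2 h'.symm)), mul_zero]
    have hs : HasSum (fun p => F p q) (∑ p ∈ B n (blk n q), F p q) := hasSum_sum_of_ne_finset_zero h
    have e1 : ∑ p ∈ B n (blk n q), F p q = w q * ∑ p ∈ B n (blk n q), u p := by
      rw [Finset.mul_sum]
      exact Finset.sum_congr rfl fun p hp => by rw [hF, if_pos (mem_B.1 hp).symm, mul_one]; ring
    rw [e1] at hs
    exact hs
  -- absolute summability on the product: rows `|u(p)|B_w(n+1)^d`
  obtain ⟨g, hg⟩ : ∃ g : X d × X d → ℝ, ∀ x, g x = |u x.1| * Bw * (if blk n x.2 = blk n x.1 then 1 else 0) := ⟨_, fun _ => rfl⟩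
  have hg0 : 0 ≤ g := fun x => by rw [hg]; split_ifs <;> [positivity; simp]
  have hgrow : ∀ p, HasSum (fun q => g (p, q)) (|u p| * Bw * ((n : ℝ) + 1) ^ d) := by
    intro p
    have h : ∀ q ∉ B n (blk n p), g (p, q) = 0 := fun q hq => by
      rw [hg, if_neg (fun h' => hq (mem_B.2 h')), mul_zero]
    have hs : HasSum (fun q => g (p, q)) (∑ q ∈ B n (blk n p), g (p, q)) := hasSum_sum_of_ne_finset_zero h
    have e1 : ∑ q ∈ B n (blk n p), g (p, q) = |u p| * Bw * ((n : ℝ) + 1) ^ d := by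
      have e2 : ∀ q ∈ B n (blk n p), g (p, q) = |u p| * Bw := fun q hq => by rw [hg, if_pos (mem_B.1 hq), mul_one]
      rw [Finset.sum_congr rfl e2, B6QGQLower276.sum_B_const]; ring
    rw [e1] at hs
    exact hs
  have hgs : Summable g := by
    refine (summable_prod_of_nonneg hg0).2 ⟨fun p => (hgrow p).summable, ?_⟩
    have e : (fun p => ∑' q, g (p, q)) = fun p => |u p| * Bw * ((n : ℝ) + 1) ^ d := funext fun p => (hgrow p).tsum_eq
    rw [e]
    exact (hus.abs.mul_right Bw).mul_right _
  have hFs : Summable (Function.uncurry F) := Summable.of_norm_bounded hgs fun x => by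
    simp only [Function.uncurry, hF, hg, Real.norm_eq_abs]
    split_ifs
    · rw [mul_one, mul_one, abs_mul]; exact mul_le_mul_of_nonneg_left (hwb x.2) (abs_nonneg _)
    · rw [mul_zero, mul_zero, abs_zero]
  refine ⟨hFs.prod.congr fun p => (hrow p).tsum_eq, ?_⟩
  have e1 : ∑' p : X d, u p * ∑ q ∈ B n (blk n p), w q = ∑' p : X d, ∑' q : X d, F p q :=
    tsum_congr fun p => (hrow p).tsum_eq.symm
  have e2 : ∑' q : X d, w q * ∑ p ∈ B n (blk n q), u p = ∑' q : X d, ∑' p : X d, F p q :=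
    tsum_congr fun q => (hcol q).tsum_eq.symm
  rw [e1, e2, hFs.tsum_comm]

/-- **THE KERNEL TERM IS SYMMETRIC FOR A SYMMETRIC KERNEL**: `|K(p,q)| ≤ εe^{−γ|p−q|₁}`, `K(p,q) = K(q,p)` ⟹
`Σ′_pu(p)Σ′_qK(p,q)w(q) = Σ′_qw(q)Σ′_pK(q,p)u(p)` — Fubini under `|u(p)|εe^{−γ|p−q|₁}B_w`. [folklore] -/
theorem kernel_symm (n : ℕ) {μ A Bw ε γ : ℝ} (hμ : 0 < μ) (hε : 0 ≤ ε) (hγ : 0 < γ) (bu bw : X d) (u w : X d → ℝ)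
    (hu : ∀ p, |u p| ≤ A * exp (-(μ * ∑ i, (((blk n p i - bu i).natAbs : ℕ) : ℝ))))
    (hw : ∀ p, |w p| ≤ Bw * exp (-(μ * ∑ i, (((blk n p i - bw i).natAbs : ℕ) : ℝ))))
    (K : X d → X d → ℝ) (hK : ∀ p q, |K p q| ≤ ε * exp (-(γ * ∑ i, (((p i - q i).natAbs : ℕ) : ℝ))))
    (hKs : ∀ p q, K p q = K q p) :
    Summable (fun p => u p * ∑' q : X d, K p q * w q) ∧
    ∑' p : X d, u p * ∑' q : X d, K p q * w q = ∑' q : X d, w q * ∑' p : X d, K q p * u p := by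
  classical
  have hBw : 0 ≤ Bw := by
    have h := (abs_nonneg _).trans (hw 0)
    exact le_of_mul_le_mul_right (by rw [zero_mul]; exact h) (exp_pos _)
  have hwb : ∀ p, |w p| ≤ Bw := fun p => (hw p).trans (mul_le_of_le_one_right hBw (exp_le_one_iff.2 (neg_nonpos.2 (by positivity))))
  have hus : Summable u := summable_of_blockProfile n hμ bu u hu
  obtain ⟨F, hF⟩ : ∃ F : X d → X d → ℝ, ∀ p q, F p q = u p * K p q * w q := ⟨_, fun _ _ => rfl⟩
  obtain ⟨g, hg⟩ : ∃ g : X d × X d → ℝ, ∀ x, g x = |u x.1| * (ε * exp (-(γ * ∑ i, (((x.1 i - x.2 i).natAbs : ℕ) : ℝ)))) * Bw :=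
    ⟨_, fun _ => rfl⟩
  have hg0 : 0 ≤ g := fun x => by rw [hg]; positivity
  have hgs : Summable g := by
    refine (summable_prod_of_nonneg hg0).2 ⟨fun p => ?_, ?_⟩
    · simp only [hg]; exact (((summable_exp_l1 hγ p).mul_left ε).mul_left _).mul_right _
    · have hrow : ∀ p, ∑' q, g (p, q) ≤ |u p| * (ε * (2 * (1 - exp (-γ))⁻¹) ^ d) * Bw := by
        intro p
        simp only [hg]
        rw [tsum_mul_right, tsum_mul_left, tsum_mul_left]
        exact mul_le_mul_of_nonneg_right (mul_le_mul_of_nonneg_left (mul_le_mul_of_nonneg_left (tsum_exp_l1_le hγ p) hε)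
          (abs_nonneg _)) hBw
      exact Summable.of_nonneg_of_le (fun p => tsum_nonneg fun q => hg0 (p, q)) hrow ((hus.abs.mul_right _).mul_right _)
  have hFs : Summable (Function.uncurry F) := Summable.of_norm_bounded hgs fun x => by
    simp only [Function.uncurry, hF, hg, Real.norm_eq_abs, abs_mul]
    exact mul_le_mul (mul_le_mul_of_nonneg_left (hK x.1 x.2) (abs_nonneg _)) (hwb x.2) (abs_nonneg _) (by positivity)
  have hrow : ∀ p, ∑' q : X d, F p q = u p * ∑' q : X d, K p q * w q := fun p => by
    rw [← tsum_mul_left]; exact tsum_congr fun q => by rw [hF]; ring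
  have hcol : ∀ q, ∑' p : X d, F p q = w q * ∑' p : X d, K q p * u p := fun q => by
    rw [← tsum_mul_left]; exact tsum_congr fun p => by rw [hF, hKs p q]; ring
  refine ⟨hFs.prod.congr fun p => hrow p, ?_⟩
  rw [← tsum_congr hrow, ← tsum_congr hcol, hFs.tsum_comm]

/-! ## §3. THE END: Green's identity for `H_V + K` on functions of block profile -/

/-- **GREEN'S IDENTITY ON `ℤ^d`**: for `u, w` with exponential block profiles, `V` bounded and a SYMMETRIC kernel of the class,
`Σ′_pu(p)·((H_V + K)w)(p) = Σ′_pw(p)·((H_V + K)u)(p)` — the stencil by summation by parts, the block average and the kernel by Fubini,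
the potential trivially; every series converging absolutely (§1). [folklore] -/
theorem green_identity (n : ℕ) (a : ℝ) {μ A Bw ε γ BV : ℝ} (hμ : 0 < μ) (hε : 0 ≤ ε) (hγ : 0 < γ) (bu bw : X d) (u w : X d → ℝ)
    (hu : ∀ p, |u p| ≤ A * exp (-(μ * ∑ i, (((blk n p i - bu i).natAbs : ℕ) : ℝ))))
    (hw : ∀ p, |w p| ≤ Bw * exp (-(μ * ∑ i, (((blk n p i - bw i).natAbs : ℕ) : ℝ))))
    (V : X d → ℝ) (hVb : ∀ p, |V p| ≤ BV)
    (K : X d → X d → ℝ) (hK : ∀ p q, |K p q| ≤ ε * exp (-(γ * ∑ i, (((p i - q i).natAbs : ℕ) : ℝ))))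
    (hKs : ∀ p q, K p q = K q p) :
    Summable (fun p => u p * (((n : ℝ) + 1) ^ 2 * ∑ ν, (2 * w p - w (p + e ν) - w (p - e ν))
      + a / ((n : ℝ) + 1) ^ d * ∑ q ∈ B n (blk n p), w q + V p * w p + ∑' q : X d, K p q * w q)) ∧
    ∑' p : X d, u p * (((n : ℝ) + 1) ^ 2 * ∑ ν, (2 * w p - w (p + e ν) - w (p - e ν))
      + a / ((n : ℝ) + 1) ^ d * ∑ q ∈ B n (blk n p), w q + V p * w p + ∑' q : X d, K p q * w q)
    = ∑' p : X d, w p * (((n : ℝ) + 1) ^ 2 * ∑ ν, (2 * u p - u (p + e ν) - u (p - e ν))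
      + a / ((n : ℝ) + 1) ^ d * ∑ q ∈ B n (blk n p), u q + V p * u p + ∑' q : X d, K p q * u q) := by
  classical
  have hBw : 0 ≤ Bw := by
    have h := (abs_nonneg _).trans (hw 0)
    exact le_of_mul_le_mul_right (by rw [zero_mul]; exact h) (exp_pos _)
  have hwb : ∀ p, |w p| ≤ Bw := fun p => (hw p).trans (mul_le_of_le_one_right hBw (exp_le_one_iff.2 (neg_nonpos.2 (by positivity))))
  have hus : Summable u := summable_of_blockProfile n hμ bu u hu
  -- the four pieces, for `(u, w)` and for `(w, u)`
  have hS := fun ν => stencil_symm n hμ bu bw u w hu hw ν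
  have hS' := fun ν => stencil_symm n hμ bw bu w u hw hu ν
  obtain ⟨hBs, hBe⟩ := blockAverage_symm n hμ bu bw u w hu hw
  obtain ⟨hBs', -⟩ := blockAverage_symm n hμ bw bu w u hw hu
  obtain ⟨hKs1, hKe⟩ := kernel_symm n hμ hε hγ bu bw u w hu hw K hK hKs
  obtain ⟨hKs1', -⟩ := kernel_symm n hμ hε hγ bw bu w u hw hu K hK hKs
  have hVs : Summable fun p => u p * (V p * w p) := by
    refine Summable.of_norm_bounded (hus.abs.mul_right (BV * Bw)) fun p => ?_
    rw [Real.norm_eq_abs, abs_mul, abs_mul]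
    exact mul_le_mul_of_nonneg_left (mul_le_mul (hVb p) (hwb p) (abs_nonneg _) ((abs_nonneg _).trans (hVb p))) (abs_nonneg _)
  have hws : Summable w := summable_of_blockProfile n hμ bw w hw
  have hA : 0 ≤ A := by
    have h := (abs_nonneg _).trans (hu 0)
    exact le_of_mul_le_mul_right (by rw [zero_mul]; exact h) (exp_pos _)
  have hub : ∀ p, |u p| ≤ A := fun p => (hu p).trans (mul_le_of_le_one_right hA (exp_le_one_iff.2 (neg_nonpos.2 (by positivity))))
  have hVs' : Summable fun p => w p * (V p * u p) := by
    refine Summable.of_norm_bounded (hws.abs.mul_right (BV * A)) fun p => ?_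
    rw [Real.norm_eq_abs, abs_mul, abs_mul]
    exact mul_le_mul_of_nonneg_left (mul_le_mul (hVb p) (hub p) (abs_nonneg _) ((abs_nonneg _).trans (hVb p))) (abs_nonneg _)
  -- the stencil summed over the directions
  have hSt : Summable fun p => u p * ∑ ν, (2 * w p - w (p + e ν) - w (p - e ν)) := by
    have h := summable_sum (s := (Finset.univ : Finset (Fin d))) fun ν _ => (hS ν).1
    refine h.congr fun p => ?_
    rw [Finset.mul_sum]
  have hSt' : Summable fun p => w p * ∑ ν, (2 * u p - u (p + e ν) - u (p - e ν)) := by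
    have h := summable_sum (s := (Finset.univ : Finset (Fin d))) fun ν _ => (hS' ν).1
    refine h.congr fun p => ?_
    rw [Finset.mul_sum]
  have hSte : ∑' p : X d, u p * ∑ ν, (2 * w p - w (p + e ν) - w (p - e ν))
      = ∑' p : X d, w p * ∑ ν, (2 * u p - u (p + e ν) - u (p - e ν)) := by
    have e1 : ∀ p, u p * ∑ ν, (2 * w p - w (p + e ν) - w (p - e ν)) = ∑ ν, u p * (2 * w p - w (p + e ν) - w (p - e ν)) :=
      fun p => Finset.mul_sum _ _ _
    have e2 : ∀ p, w p * ∑ ν, (2 * u p - u (p + e ν) - u (p - e ν)) = ∑ ν, w p * (2 * u p - u (p + e ν) - u (p - e ν)) :=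
      fun p => Finset.mul_sum _ _ _
    rw [tsum_congr e1, tsum_congr e2, Summable.tsum_finsetSum (fun ν _ => (hS ν).1), Summable.tsum_finsetSum (fun ν _ => (hS' ν).1)]
    exact Finset.sum_congr rfl fun ν _ => (hS ν).2
  -- expand both sides into the four pieces
  have eL : ∀ p, u p * (((n : ℝ) + 1) ^ 2 * ∑ ν, (2 * w p - w (p + e ν) - w (p - e ν))
      + a / ((n : ℝ) + 1) ^ d * ∑ q ∈ B n (blk n p), w q + V p * w p + ∑' q : X d, K p q * w q)
      = ((n : ℝ) + 1) ^ 2 * (u p * ∑ ν, (2 * w p - w (p + e ν) - w (p - e ν)))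
        + a / ((n : ℝ) + 1) ^ d * (u p * ∑ q ∈ B n (blk n p), w q) + u p * (V p * w p) + u p * ∑' q : X d, K p q * w q :=
    fun p => by ring
  have eR : ∀ p, w p * (((n : ℝ) + 1) ^ 2 * ∑ ν, (2 * u p - u (p + e ν) - u (p - e ν))
      + a / ((n : ℝ) + 1) ^ d * ∑ q ∈ B n (blk n p), u q + V p * u p + ∑' q : X d, K p q * u q)
      = ((n : ℝ) + 1) ^ 2 * (w p * ∑ ν, (2 * u p - u (p + e ν) - u (p - e ν)))
        + a / ((n : ℝ) + 1) ^ d * (w p * ∑ q ∈ B n (blk n p), u q) + w p * (V p * u p) + w p * ∑' q : X d, K p q * u q :=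
    fun p => by ring
  have hL : Summable fun p => ((n : ℝ) + 1) ^ 2 * (u p * ∑ ν, (2 * w p - w (p + e ν) - w (p - e ν)))
      + a / ((n : ℝ) + 1) ^ d * (u p * ∑ q ∈ B n (blk n p), w q) + u p * (V p * w p) + u p * ∑' q : X d, K p q * w q :=
    (((hSt.mul_left _).add (hBs.mul_left _)).add hVs).add hKs1
  refine ⟨hL.congr fun p => (eL p).symm, ?_⟩
  rw [tsum_congr eL, tsum_congr eR,
    (((hSt.mul_left _).add (hBs.mul_left _)).add hVs).tsum_add hKs1,
    ((hSt.mul_left _).add (hBs.mul_left _)).tsum_add hVs, (hSt.mul_left _).tsum_add (hBs.mul_left _),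
    (((hSt'.mul_left _).add (hBs'.mul_left _)).add hVs').tsum_add hKs1',
    ((hSt'.mul_left _).add (hBs'.mul_left _)).tsum_add hVs', (hSt'.mul_left _).tsum_add (hBs'.mul_left _),
    tsum_mul_left, tsum_mul_left, tsum_mul_left, tsum_mul_left, hSte, hBe, hKe]
  have eV : ∑' p : X d, u p * (V p * w p) = ∑' p : X d, w p * (V p * u p) := tsum_congr fun p => by ring
  rw [eV]

/-! ## §4. Toy -/

/-- Toy (`d = 2`, mesh `n = 4`, rate `1`): a unit-rate block profile is summable over the FINE lattice `ℤ²`. -/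
example : Summable (fun p : X 2 => exp (-(1 * ∑ i, (((blk 4 p i - (0 : X 2) i).natAbs : ℕ) : ℝ)))) :=
  summable_blockProfile (d := 2) 4 one_pos 0

end Summit.QuantumFields.BalabanUV.T4Continuum.NE7b.SupZdGreenIdentity
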